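import Summits.QuantumFields.YangMills.Theorems.LuscherReductionRunningReductionCoarseUpperCopies
import Summits.QuantumFields.YangMills.Theorems.LuscherReductionTwistedTraceScalingC4CoreRecord
import HarnessLib

/-!
# C4-SHELL, the eight-copies step: the small-action SHELL GAIN follows from its ONE-ORBIT form for GAUGE-invariant functions
# (lane A of S-BASE, crux `TwistedTraceScaling` stmt-QuantumFields-20203, line «twolattice», stub `stub_fixedLatticeTraceLaw`; lead g23; card
# `pub/ym-fleet/ym-luscher-20007-p1/Lines-shell-gain.md`)

`InnerShellGainSmallAt L δc δ η` (✓`…InnerTwoZone`, the one remaining hypothesis of COARSE-UPPER(L) by ✓`…C4CoreRecord.coarseUpper_of_shellSmall`) quantifies over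
PHYSICAL (gauge- AND twist-invariant) functions supported in the union of the eight shells `{∃ z, orbitDist(τ_z U) < δ} ∩ {∀ z, δc/2 < orbitDist(τ_z U)} ∩ {S < 2η}`.
The Born–Oppenheimer analysis of the shell (as that of the core) works near ONE pure-gauge orbit with gauge-invariant functions only.  This file states the
one-orbit form and proves it suffices — the shell twin of ✓`innerNoIntruderAt_of_oneOrbit` (`…CoarseUpperCopies`), with a SUP bound in place of min–max:
* `ShellGainOneOrbitAt L δc δ η` — **the one-orbit shell gain**: for every `A`, eventually in `β`, every bounded measurable GAUGE-invariant `G` supported in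
  `{S < 2η(β)} ∩ {orbitDist < δ(β)} ∩ {δc(β)/2 < orbitDist}` has `⟨G, K_β G⟩ ≤ e^{−A·λ_b(L³β)}·λ₀(β,L)·‖G‖²`;
* ★★ `innerShellGainSmallAt_of_oneOrbit : (∀ β, 0 < δ β) → (∃ β₁, ∀ β ≥ β₁, δ β ≤ 1/(2L)) → ShellGainOneOrbitAt L δc δ η → InnerShellGainSmallAt L δc δ η` —
  a physical `φ` supported in the eight shells is the twist symmetrisation of its one-orbit cut `G = orbitCut δ φ` (✓`twistSum_orbitCut`), `‖φ‖² = 8‖G‖²` (✓`l2_twistSum`),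
  `⟨φ,Kφ⟩ ≤ 8⟨G,KG⟩ + 56·crossBound·‖G‖²` (✓`abs_qform_twistSum_sub_le`), the cross terms are `≤ 4e^{−(|A|+1)}·λ_b·λ₀‖G‖²/28·…` eventually (✓`crossBound_eventually_small`
  + the β-uniform floor ✓`levelValue_zero_ge_uniform`), and `e^{−(A+1)λ}(1 + λ) ≤ e^{−Aλ}`;
* ★★ `innerShellGainSmallAt_pow_of_oneOrbit` — polynomial radii: `ShellGainOneOrbitAt L (β^{−a}) (β^{−b}) (β^{−q}) → InnerShellGainSmallAt L (β^{−a}) (β^{−b}) (β^{−q})` for `0 < b`;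
* ★★★ `coarseUpper_of_shellOneOrbit` — hence COARSE-UPPER(L) (`L ≥ 2`) ⟸ `ShellGainOneOrbitAt L (β^{−s}) (β^{−1/40}) (β^{−17/20})` for any `s ∈ (1/6, 1/5)` (✓`coarseUpper_of_shellSmall`).
HONEST FRAMING: a kernel-checked reduction; `ShellGainOneOrbitAt` at these scales is OPEN (it is the C4-SHELL content); COARSE-UPPER/LOWER/TAIL, the stubs and the crux
`TwistedTraceScaling` stay OPEN; CONDITIONAL route R2b1; not infinite volume, not a mass gap, not Clay.  One definition (the one-orbit target text), no `sorry`.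
-/

set_option autoImplicit false

noncomputable section

open MeasureTheory Filter Topology Real
open scoped BigOperators
open Literature.MathematicalPhysics.QuantumFieldTheory
open Literature.MathematicalPhysics.QuantumLattice

namespace Summit.QuantumFields.YangMills.Theorems.FemtoTransferGap

variable (L : ℕ) [NeZero L]

/-! ## §1 The one-orbit target text -/

/-- **C4-SHELL at ONE orbit — the small-action SHELL GAIN for gauge-invariant functions near the trivial orbit** (target text; OPEN).  For every `A`,
eventually in `β`: every bounded measurable GAUGE-invariant `G` supported in `{S(U) < 2η(β)} ∩ {orbitDist U < δ(β)} ∩ {δc(β)/2 < orbitDist U}` satisfies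
`⟨G, K_β G⟩ ≤ e^{−A·λ_b(L³β)} · λ₀(β, L) · ‖G‖²`.  Why it should hold at `(δc, δ) = (β^{−a}, β^{−b})`, `b < a < 4b/3`, `a < 1/5`: Born–Oppenheimer on the tube of slow
radius `β^{−b}` (relative fibre error `O(β^{−2b}·polylog)`, second order by the colour symmetry) against the ONE-SITE annulus gain `≍ (β^{−a})^{3/2}/80` of
✓`oneSite_shell_gain` in `μ₀`-currency, and the record floor `e^{−ελ_b/4}σμ₀ ≤ λ₀`. [cite: Luscher1983, §3] [cite: SimonB1983DiscreteSpectrum, §3] -/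
def ShellGainOneOrbitAt (δc δ η : ℝ → ℝ) : Prop :=
  ∀ A : ℝ, ∃ β0 : ℝ, ∀ β : ℝ, β0 ≤ β → ∀ G : GaugeConfig 3 L SU2 → ℝ, Measurable G → (∃ C : ℝ, ∀ U, |G U| ≤ C) →
    (∀ (g : Site 3 L → SU2) (U : GaugeConfig 3 L SU2), G (gaugeTransform g U) = G U) →
    (∀ U, G U ≠ 0 → wilsonAction su2Rep U < 2 * η β ∧ orbitDist U < δ β ∧ δc β / 2 < orbitDist U) →
      qform su2Rep β G G ≤ Real.exp (-(A * bareLambda ((L : ℝ) ^ 3 * β))) * levelValue su2Rep L β 0 * l2 G G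

variable {L}

/-! ## §2 Bookkeeping for the one-orbit cut -/

/-- Where the cut is nonzero the function is nonzero. [folklore] -/
theorem ne_zero_of_orbitCut_ne_zero {δ : ℝ} {F : GaugeConfig 3 L SU2 → ℝ} {U : GaugeConfig 3 L SU2} (h : orbitCut δ F U ≠ 0) : F U ≠ 0 := by
  unfold orbitCut at h
  split_ifs at h with hlt
  · exact h
  · exact absurd rfl h

/-- Pure-real endgame of the eight-copies step for a SUP bound: `8·e^{−(A+1)λ}Λ₀n + 56·cB·n ≤ e^{−Aλ}Λ₀(8n)` once `7cB ≤ e^{−(A+1)λ}·λ·Λ₀`. [folklore] -/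
theorem shell_copies_endgame {qF qG nG Λ0 cB lam A : ℝ} (hnG : 0 ≤ nG) (hΛ0 : 0 ≤ Λ0)
    (hq : qF ≤ 8 * qG + 56 * (cB * nG)) (hG : qG ≤ Real.exp (-((A + 1) * lam)) * Λ0 * nG)
    (hsc : 7 * cB ≤ Real.exp (-((A + 1) * lam)) * lam * Λ0) :
    qF ≤ Real.exp (-(A * lam)) * Λ0 * (8 * nG) := by
  have h1 : 56 * (cB * nG) ≤ 8 * (Real.exp (-((A + 1) * lam)) * lam * Λ0) * nG := by
    have := mul_le_mul_of_nonneg_right hsc hnG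
    nlinarith
  have h2 : qF ≤ 8 * (Real.exp (-((A + 1) * lam)) * Λ0 * nG) * (1 + lam) := by nlinarith
  have h3 : Real.exp (-((A + 1) * lam)) * (1 + lam) ≤ Real.exp (-(A * lam)) := by
    have hle : 1 + lam ≤ Real.exp lam := by linarith [Real.add_one_le_exp lam]
    have := mul_le_mul_of_nonneg_left hle (Real.exp_pos (-((A + 1) * lam))).le
    rw [← Real.exp_add] at this
    have e : -((A + 1) * lam) + lam = -(A * lam) := by ring
    rwa [e] at this
  have h4 : 8 * (Real.exp (-((A + 1) * lam)) * Λ0 * nG) * (1 + lam) = 8 * (Real.exp (-((A + 1) * lam)) * (1 + lam)) * (Λ0 * nG) := by ring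
  have h5 : 8 * (Real.exp (-((A + 1) * lam)) * (1 + lam)) * (Λ0 * nG) ≤ 8 * Real.exp (-(A * lam)) * (Λ0 * nG) :=
    mul_le_mul_of_nonneg_right (mul_le_mul_of_nonneg_left h3 (by norm_num)) (mul_nonneg hΛ0 hnG)
  linarith [h2, h4.le, h5]

/-- `7·cB ≤ e^{−(A+1)λ}·λ·Λ₀` eventually: the cross terms between the eight copies are negligible against any fixed gain (`λ = λ_b(L³β) ≤ 1` eventually,
✓`crossBound_eventually_small` with `ε = 4e^{−(|A|+1)}`, β-uniform floor). [folklore] -/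
theorem crossBound_le_gain (A : ℝ) : ∃ β0 : ℝ, ∀ β : ℝ, β0 ≤ β →
    7 * crossBound L β (1 / (2 * L)) ≤ Real.exp (-((A + 1) * bareLambda ((L : ℝ) ^ 3 * β))) * bareLambda ((L : ℝ) ^ 3 * β) * levelValue su2Rep L β 0 := by
  have hL : (0 : ℝ) < L := by exact_mod_cast Nat.pos_of_ne_zero (NeZero.ne L)
  have hε : 0 < 4 * Real.exp (-(|A| + 1)) := by positivity
  obtain ⟨βs, hs⟩ := crossBound_eventually_small (L := L) (m := 1 / (2 * L)) (by positivity) hε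
  refine ⟨max (max 1 βs) (2 / (1 : ℝ) ^ 3), fun β hβ => ?_⟩
  have hβ1 : 1 ≤ β := ((le_max_left _ _).trans (le_max_left _ _)).trans hβ
  have hβ0 : 0 < β := by linarith
  have hβs : βs ≤ β := ((le_max_right _ _).trans (le_max_left _ _)).trans hβ
  have hβτ : 2 / (1 : ℝ) ^ 3 ≤ β := (le_max_right _ _).trans hβ
  have hL1 : (1 : ℝ) ≤ (L : ℝ) ^ 3 := one_le_pow₀ (by exact_mod_cast NeZero.one_le)
  have hB'0 : 0 < (L : ℝ) ^ 3 * β := by nlinarith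
  have hlam0 : 0 < bareLambda ((L : ℝ) ^ 3 * β) := bareLambda_pos' hB'0
  have hlam1 : bareLambda ((L : ℝ) ^ 3 * β) ≤ 1 := bareLambda_cube_le (L := L) one_pos hβτ
  set lam := bareLambda ((L : ℝ) ^ 3 * β) with hlamdef
  have hΛ0 : 0 < levelValue su2Rep L β 0 := levelValue_su2Rep_pos hβ0 0
  -- `28 cB ≤ ε λ Λ₀`
  have h1 : 28 * crossBound L β (1 / (2 * L)) ≤ 4 * Real.exp (-(|A| + 1)) * lam * levelValue su2Rep L β 0 :=
    (hs β hβs).trans (mul_le_mul_of_nonneg_left (levelValue_zero_ge_uniform hβ1) (by positivity))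
  -- `e^{−(|A|+1)} ≤ e^{−(A+1)λ}` for `0 ≤ λ ≤ 1`
  have h2 : Real.exp (-(|A| + 1)) ≤ Real.exp (-((A + 1) * lam)) := by
    refine Real.exp_le_exp.2 ?_
    have hA : (A + 1) * lam ≤ (|A| + 1) * lam := mul_le_mul_of_nonneg_right (by linarith [le_abs_self A]) hlam0.le
    have hB : (|A| + 1) * lam ≤ (|A| + 1) * 1 := mul_le_mul_of_nonneg_left hlam1 (by positivity)
    linarith
  have h3 : 4 * Real.exp (-(|A| + 1)) * lam * levelValue su2Rep L β 0 ≤ 4 * Real.exp (-((A + 1) * lam)) * lam * levelValue su2Rep L β 0 := by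
    have := mul_le_mul_of_nonneg_right (mul_le_mul_of_nonneg_right h2 hlam0.le) hΛ0.le
    linarith
  linarith [h1, h3]

/-! ## §3 The shell gain from its one-orbit form -/

/-- ★★ **C4-SHELL from ONE orbit**: for positive outer radii that are eventually `≤ 1/(2L)`, `ShellGainOneOrbitAt L δc δ η → InnerShellGainSmallAt L δc δ η`.
[cite: Luscher1983, §3] [cite: SimonB1983DiscreteSpectrum, §3] -/
theorem innerShellGainSmallAt_of_oneOrbit {δc δ η : ℝ → ℝ} (hδ : ∀ β, 0 < δ β) (hδL : ∃ β1 : ℝ, ∀ β : ℝ, β1 ≤ β → δ β ≤ 1 / (2 * L))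
    (h1 : ShellGainOneOrbitAt L δc δ η) : InnerShellGainSmallAt L δc δ η := by
  intro A
  have hL : (0 : ℝ) < L := by exact_mod_cast Nat.pos_of_ne_zero (NeZero.ne L)
  obtain ⟨βI, hI⟩ := h1 (A + 1)
  obtain ⟨β1, hδ1⟩ := hδL
  obtain ⟨βc, hc⟩ := crossBound_le_gain (L := L) A
  refine ⟨max (max 1 βI) (max β1 βc), fun β hβ φ hφ hsupp => ?_⟩
  have hβ1 : 1 ≤ β := ((le_max_left _ _).trans (le_max_left _ _)).trans hβ
  have hβ0 : 0 < β := by linarith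
  have hβI : βI ≤ β := ((le_max_right _ _).trans (le_max_left _ _)).trans hβ
  have hβd : β1 ≤ β := ((le_max_left _ _).trans (le_max_right _ _)).trans hβ
  have hβc : βc ≤ β := ((le_max_right _ _).trans (le_max_right _ _)).trans hβ
  have hΛ0 : 0 < levelValue su2Rep L β 0 := levelValue_su2Rep_pos hβ0 0
  -- geometry of the scales
  have hδ0 := hδ β
  have hδ2 : δ β ≤ 1 / (2 * L) := hδ1 β hβd
  have hLδ : (L : ℝ) * δ β < 2 := by
    have := mul_le_mul_of_nonneg_left hδ2 hL.le
    have e : (L : ℝ) * (1 / (2 * L)) = 1 / 2 := by field_simp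
    linarith
  have hLm : (L : ℝ) * (δ β + 1 / (2 * L)) < 2 := by
    have := mul_le_mul_of_nonneg_left hδ2 hL.le
    have e : (L : ℝ) * (1 / (2 * L)) = 1 / 2 := by field_simp
    nlinarith
  -- the one-orbit cut
  obtain ⟨C, hC⟩ := hφ.bounded
  set G : GaugeConfig 3 L SU2 → ℝ := orbitCut (δ β) φ with hGdef
  have hGm : Measurable G := measurable_orbitCut _ hφ.measurable
  have hGb' : ∀ U, |G U| ≤ C := fun U => abs_orbitCut_le _ hC U
  have hGb : ∃ C' : ℝ, ∀ U, |G U| ≤ C' := ⟨C, hGb'⟩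
  have hGg : ∀ (g : Site 3 L → SU2) (U : GaugeConfig 3 L SU2), G (gaugeTransform g U) = G U := fun g U =>
    orbitCut_gaugeTransform _ hφ.gaugeInv g U
  have hGs : ∀ U, G U ≠ 0 → orbitDist U < δ β := fun U h => orbitDist_lt_of_orbitCut_ne_zero h
  have hGsupp : ∀ U, G U ≠ 0 → wilsonAction su2Rep U < 2 * η β ∧ orbitDist U < δ β ∧ δc β / 2 < orbitDist U := fun U h => by
    have hφU := hsupp U (ne_zero_of_orbitCut_ne_zero h)
    refine ⟨hφU.1, hGs U h, ?_⟩
    have := hφU.2.2 (fun _ => false)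
    rwa [TT.twist3_false] at this
  -- `φ = twistSum G`
  have hsupp' : ∀ U, φ U ≠ 0 → ∃ z : Fin 3 → Bool, orbitDist (TT.twist3 z U) < δ β := fun U h => (hsupp U h).2.1
  have hcomb : φ = twistSum G := (twistSum_orbitCut hLδ hφ hsupp').symm
  have hl2 : l2 φ φ = 8 * l2 G G := by rw [hcomb]; exact l2_twistSum hGm hGb' hLδ hGs
  have hq : qform su2Rep β φ φ ≤ 8 * qform su2Rep β G G + 56 * (crossBound L β (1 / (2 * L)) * l2 G G) := by
    rw [hcomb]
    have h := abs_qform_twistSum_sub_le hβ0.le hGm hGb' (by positivity : (0 : ℝ) ≤ 1 / (2 * L)) hLm hGs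
    rw [abs_le] at h
    linarith [h.2]
  -- apply the one-orbit gain and conclude
  have hIG := hI β hβI G hGm hGb hGg hGsupp
  rw [hl2]
  exact shell_copies_endgame (l2_self_nonneg_lat _) hΛ0.le hq hIG (hc β hβc)

/-- ★★ **Polynomial radii**: `ShellGainOneOrbitAt L (β^{−a}) (β^{−b}) (β^{−q}) → InnerShellGainSmallAt L (β^{−a}) (β^{−b}) (β^{−q})` for every outer exponent `0 < b`.
[cite: Luscher1983, §3] -/
theorem innerShellGainSmallAt_pow_of_oneOrbit {a b q : ℝ} (hb : 0 < b)
    (h1 : ShellGainOneOrbitAt L (powScale a) (powScale b) (powScale q)) :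
    InnerShellGainSmallAt L (powScale a) (powScale b) (powScale q) := by
  have hL : (0 : ℝ) < L := by exact_mod_cast Nat.pos_of_ne_zero (NeZero.ne L)
  exact innerShellGainSmallAt_of_oneOrbit (fun β => powScale_pos b β) (powScale_eventually_le hb (by positivity)) h1

/-- ★★★ **COARSE-UPPER(L) ⟸ the ONE-ORBIT shell gain at the record radii** (`L ≥ 2`, `1/6 < s < 1/5`): `ShellGainOneOrbitAt L (β^{−s}) (β^{−1/40}) (β^{−17/20})`
gives `λ_k(L,β) ≤ e^{−dΛ/L}·λ₀(L,β)` for every `k`, every `d < Δ_k`, deep in the femto window. [cite: Luscher1983, §3] [cite: LuscherMunster1984, §2] -/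
theorem coarseUpper_of_shellOneOrbit (hL2 : 2 ≤ L) {s : ℝ} (hs6 : 1 / 6 < s) (hs5 : s < 1 / 5)
    (h1 : ShellGainOneOrbitAt L (powScale s) (powScale (1 / 40)) (powScale (17 / 20))) :
    ∀ k : ℕ, ∀ d : ℝ, d < levelGap k → ∃ lam0 : ℝ, 0 < lam0 ∧ ∀ lam : ℝ, 0 < lam → lam ≤ lam0 →
      ∀ β : ℝ, InFemtoWindow lam β L →
        levelValue su2Rep L β k ≤ Real.exp (-(d * luscherLambda β L) / L) * levelValue su2Rep L β 0 :=
  TwoLattice.ConstTube.coarseUpper_of_shellSmall hL2 hs6 hs5 (innerShellGainSmallAt_pow_of_oneOrbit (by norm_num) h1)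

end Summit.QuantumFields.YangMills.Theorems.FemtoTransferGap

end
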